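import Summits.HodgeConjecture.HodgeConjecture.Theorems.VHCAbelianSchemesRoadSecantQuotientPinnedLevelTransferDefs
import Literature.AlgebraicGeometry.Motives.JacobianHyperelliptic
import HarnessLib

/-!
# Road b02 (`VHCAbelianSchemesRoad`, D-0059) — G1♭ SPLIT AT THE HYPERELLIPTIC ANCHORS: «transfer to pinned anchors presented by a NON-hyperelliptic
# datum» (`…OffHyperelliptic`, print's territory) ∧ «transfer to pinned anchors presented by a HYPERELLIPTIC datum» (`…AtHyperelliptic`, the first
# honest special-anchor closedness case) ⟺ G1♭ (definitions and fact-free glue; lane R, crux `SemiregularSheafRepresentativesTwPrimeAtDiag`,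
# item stmt-HodgeConjecture-20707, skeleton v3.3)

research route conditional on HC_CM; not a corollary; Q11.4-sentence-2 already refuted in dim ≥ 3.

DEFINITIONS AND FACT-FREE GLUE ONLY (`HC_CM` nowhere; nothing asserted; helper under the registered stub `stub_residual_63_secantQuotientPinnedPrime`;
director-hodge rulings R10.4 (2) ∕ R10.5 (3)(iii) ∕ R10.6 (2)(iii): «G1's first special-anchor closedness case = closedness at ONE named special-anchor class —
the hyperelliptic locus — paper statement first as one typed ∀-lemma»). The companion file `…SecantQuotientPinnedLevelTransferDefs` (p566937) isolated
G1's closedness content as G1♭ (`SecantQuotientPinnedAnchorLevelTransfer63 𝒪`: same-level transfer of carried-ness to every PINNED anchor) and showed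
node ⟺ G1♭ ∧ G3. Re-reading arXiv:2502.03415 §9 as a ∀-statement: its construction of the semiregular twisted sheaf `𝓑` on `(J(C) × Ĵ(C))∕Ḡ` uses,
besides the level data's general position (Lemma 9.1.2 ∕ 9.1.4 ∕ 9.3.1 — the `TranslatesInGeneralPosition` field of every `SecantQuotientDatum`), ONLY
that `C` is NON-HYPERELLIPTIC (p. 57 «we will not need these facts and assume only that `C` is non-hyperelliptic»; Noether's theorem for the
non-hyperelliptic curve in the rank-6 computation of the obstruction map, p. 46, on which Lemma 9.3.11's semiregularity rests; `Θ = W₂ ≅ C^{(2)}` smooth).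
So the pinned anchors print does NOT serve are exactly those presented by a datum with HYPERELLIPTIC curve, and G1♭ splits EXACTLY (§2,
`pinnedLevelTransfer63_iff_offHyperelliptic_and_atHyperelliptic`) into

* `SecantQuotientPinnedAnchorLevelTransfer63OffHyperelliptic 𝒪` — G1♭ at targets presented (pin equation `e⁻¹^*θ = h_Y(θ₀)`, `θ₀ ∈ ℚˣ·[Θ]`) by a
  datum whose Jacobian is NOT hyperelliptic (`¬ D.𝒥.IsHyperelliptic`, `Literature/…/Motives/JacobianHyperelliptic`): PRINT'S TERRITORY — for the doors
  admitting Markman's sheaf it follows from the ∀-reading of §9 at the target alone (no source needed); in the TREE it is OPEN (the claim-fact L1″ is the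
  ∃-form; the ∀-form over non-hyperelliptic data is not stated as a Literature fact — preprint, reading of «generic» = «non-hyperelliptic + Lemma 9.3.1»
  is this lane's, recorded here, not asserted);
* `SecantQuotientPinnedAnchorLevelTransfer63AtHyperelliptic 𝒪` — G1♭ at targets presented by a datum whose Jacobian IS hyperelliptic: THE FIRST HONEST
  SPECIAL-ANCHOR CASE — closedness of carried-ness across the hyperelliptic divisor of the level family. RESEARCH CONTENT; print silent. PRECISE
  OBSTRUCTIONS (evidence of this seat on the item): (a) Markman's semiregularity mechanism is unavailable — for hyperelliptic `C` the differential of Torelli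
  `H¹(T_C) → Sym²H¹(𝒪_C)` has a kernel (Noether), so `dim H⁰(N_{C_n∕X})` jumps and the rank-6 statement (hence Lemma 9.3.2 ∕ 9.3.11) fails as stated;
  (b) `Θ = W₂` is singular at the `g¹₂` (Riemann–Kempf), so Prop. 9.2.2's smooth surfaces `Θ̃_{ij}` degenerate; (c) `−AJ(C)` is a translate of `AJ(C)`
  (`ι(C_p) = C_{ιp}`), so `F₁` and `F₂` have the same type; (d) the deformation route gives openness only: a Langton-type limit of the `𝓑_t` exists at a
  hyperelliptic fibre IF `𝓔̄` is `h`-stable (not in print: `𝓔` is «simple»), with the right `κ` (flat), and the whole question is the SEMIREGULARITY OF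
  THAT LIMIT. WHY IT MIGHT HOLD: carried-ness is open and the class stays algebraic on the whole Weil-type component (Thm. 1.5.1 + Baire), so only the
  object is missing; WHY IT MIGHT FAIL: limits of semiregular sheaves need not be semiregular.

Both are `@[conjecture]`, OPEN, HYPOTHESES wherever used; primed instances for `tw C AdmTw′`; §2 the exact glue (excluded middle on the hyperellipticity of
the datum presenting the target's pin) and the stub junction `L1″ ∧ Off′ ∧ At′ ∧ G3′ ⟹ 2a‴`. Nothing here says G1♭, Off, At, G3, the node, L1″, any stub ∕
cell ∕ rung ∕ crux, K-SR♭∃, VHC, `HC_AV`, `HC_CM` or HC holds. References: [cite: Markman2025SecantWeil, §1.5 (p. 7), Thm. 1.4.1 (item 4), Thm. 1.5.1, §6 (p. 46: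
Noether's theorem, rank 6), §9 (p. 57), §9.1 Lemma 9.1.2 ∕ 9.1.4, §9.2 Prop. 9.2.2, §9.3 Lemma 9.3.1 ∕ 9.3.2 ∕ 9.3.11] [cite: ArbarelloCornalbaGriffithsHarris1985,
Ch. I §2 (p. 10) and §3; Ch. IV (Riemann–Kempf singularity theorem)] [cite: BuchweitzFlenner2003, §5 Thm. 5.1] [cite: Bloch1972Semiregularity, Remark (7.5)]
[cite: HuybrechtsLehn1997, §2.B (Langton) and §10.1].
-/

noncomputable section

open CategoryTheory CategoryTheory.Limits AlgebraicGeometry Topology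

namespace Summit.HodgeConjecture.HodgeConjecture.Ring2.SemiregularRepresentatives

set_option linter.dupNamespace false -- the cell's namespace repeats the summit name, as in every `Ring2*` file

open Literature.AlgebraicGeometry Literature.AlgebraicGeometry.Motives Literature.AlgebraicGeometry.Motives.AbelianVariety
open Literature.AlgebraicGeometry.HodgeTheory Literature.AlgebraicGeometry.Markman2025
open Literature.AlgebraicTopology.SingularHomology
open Summit.Ventures.HSemireg (ObjClass)
open Summit.HodgeConjecture.HodgeConjecture.Ring2.AbelianAll (carriedClasses)

/-! ## §1 The two halves of G1♭ -/

/-- **G1♭ OFF THE HYPERELLIPTIC LOCUS (`SecantQuotientPinnedAnchorLevelTransfer63OffHyperelliptic 𝒪`)**: same-level transfer of carried-ness of some rational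
pinned-served class TO every pinned level-`d` anchor `(X, θ)` that is PRESENTED (`e : X ≅ D.Y.X`, `e⁻¹^*θ = h_Y(θ₀)`, `θ₀ ∈ ℚˣ·[Θ_D]`) by a secant–quotient
datum `D` whose Jacobian is NOT hyperelliptic. Print's territory (arXiv:2502.03415 §9 read as a ∀-statement over non-hyperelliptic data in general
position gives a carrier at the target outright, for doors admitting Markman's `𝓑`); OPEN in the tree (L1″ is the ∃-form); a HYPOTHESIS wherever used.
[cite: Markman2025SecantWeil, §9 (p. 57), Lemma 9.3.1 and Lemma 9.3.11] [cite: ArbarelloCornalbaGriffithsHarris1985, Ch. I §2 (p. 10)] [status: open] -/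
@[conjecture] def SecantQuotientPinnedAnchorLevelTransfer63OffHyperelliptic (𝒪 : ObjClass) : Prop :=
  ∀ (d : ℕ) ⦃X X' : SchemeOver ℂ⦄ ⦃θ : complexBetti X 2⦄ ⦃θ' : complexBetti X' 2⦄,
    IsSecantQuotientAnchorWith d X θ → secantQuotientAnchorsPinned X θ →
    (∃ (D : SecantQuotientDatum) (e : X ≅ D.Y.X) (θ₀ : complexBetti D.𝒥.J.X 2),
      ¬ D.𝒥.IsHyperelliptic ∧ D.𝒥.J.IsPolarizationClassOf D.Θ θ₀ ∧ complexBetti.map e.inv 2 θ = D.hY θ₀) →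
    IsSecantQuotientAnchorWith d X' θ' →
    (∃ w' : complexBetti X' (2 * 3), w' ∈ secantQuotientServedClassesPinned X' θ' ∧ IsRationalClass w' ∧ w' ∈ carriedClasses 𝒪 6 3 X' θ') →
    ∃ w : complexBetti X (2 * 3), w ∈ secantQuotientServedClassesPinned X θ ∧ IsRationalClass w ∧ w ∈ carriedClasses 𝒪 6 3 X θ

/-- **G1♭ AT THE HYPERELLIPTIC LOCUS (`SecantQuotientPinnedAnchorLevelTransfer63AtHyperelliptic 𝒪`) — THE FIRST HONEST SPECIAL-ANCHOR CLOSEDNESS CASE**: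
same-level transfer of carried-ness TO every pinned level-`d` anchor presented by a secant–quotient datum `D` whose Jacobian IS hyperelliptic
(`D.𝒥.IsHyperelliptic`: two distinct effective degree-2 divisors with equal difference class). Print is silent here (non-hyperellipticity is used through
Noether's theorem in the rank-6 obstruction computation behind Lemma 9.3.11, and `W₂` is singular); the content is CLOSEDNESS of carried-ness across the
hyperelliptic divisor of the connected level family — the class stays algebraic there (Thm. 1.5.1 + Baire), only the OBJECT is in question (module
docstring (a)–(d)). OPEN; a HYPOTHESIS wherever used. [cite: Markman2025SecantWeil, Thm. 1.5.1, §6 (p. 46), §9.2 Prop. 9.2.2 and §9.3 Lemma 9.3.11]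
[cite: ArbarelloCornalbaGriffithsHarris1985, Ch. I §2 (p. 10)] [cite: BuchweitzFlenner2003, §5 Thm. 5.1] [status: open] -/
@[conjecture] def SecantQuotientPinnedAnchorLevelTransfer63AtHyperelliptic (𝒪 : ObjClass) : Prop :=
  ∀ (d : ℕ) ⦃X X' : SchemeOver ℂ⦄ ⦃θ : complexBetti X 2⦄ ⦃θ' : complexBetti X' 2⦄,
    IsSecantQuotientAnchorWith d X θ → secantQuotientAnchorsPinned X θ →
    (∃ (D : SecantQuotientDatum) (e : X ≅ D.Y.X) (θ₀ : complexBetti D.𝒥.J.X 2),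
      D.𝒥.IsHyperelliptic ∧ D.𝒥.J.IsPolarizationClassOf D.Θ θ₀ ∧ complexBetti.map e.inv 2 θ = D.hY θ₀) →
    IsSecantQuotientAnchorWith d X' θ' →
    (∃ w' : complexBetti X' (2 * 3), w' ∈ secantQuotientServedClassesPinned X' θ' ∧ IsRationalClass w' ∧ w' ∈ carriedClasses 𝒪 6 3 X' θ') →
    ∃ w : complexBetti X (2 * 3), w ∈ secantQuotientServedClassesPinned X θ ∧ IsRationalClass w ∧ w ∈ carriedClasses 𝒪 6 3 X θ

/-- Off the hyperelliptic locus, for the PRIMED twisted door `tw C AdmTw′`. OPEN; a HYPOTHESIS wherever used.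
[cite: Markman2025SecantWeil, §9 (p. 57) and Lemma 9.3.11] [cite: BuchweitzFlenner2003, §5 Thm. 5.1] [status: open] -/
@[conjecture] def SecantQuotientPinnedAnchorLevelTransfer63OffHyperellipticPinnedPrime (C : ChernCharacterBetti) : Prop :=
  SecantQuotientPinnedAnchorLevelTransfer63OffHyperelliptic (Literature.AlgebraicGeometry.HodgeTheory.twistedReflexiveClass C
    (fun n X₀ I E => Summit.Ventures.HSemireg.gluableSigmaAdmissible n X₀ I E ∨
      Literature.AlgebraicGeometry.HodgeTheory.bfSingleAdmissible' n X₀ I E))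

/-- At the hyperelliptic locus, for the PRIMED twisted door `tw C AdmTw′` — the named special-anchor case behind stub 2a‴ of skeleton v3.3. OPEN; a
HYPOTHESIS wherever used. [cite: Markman2025SecantWeil, Thm. 1.5.1 and §9.3 Lemma 9.3.11] [cite: BuchweitzFlenner2003, §5 Thm. 5.1]
[cite: Pridham2024Semiregularity, Cor. 2.25 and Rem. 2.26] [status: open] -/
@[conjecture] def SecantQuotientPinnedAnchorLevelTransfer63AtHyperellipticPinnedPrime (C : ChernCharacterBetti) : Prop :=
  SecantQuotientPinnedAnchorLevelTransfer63AtHyperelliptic (Literature.AlgebraicGeometry.HodgeTheory.twistedReflexiveClass C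
    (fun n X₀ I E => Summit.Ventures.HSemireg.gluableSigmaAdmissible n X₀ I E ∨
      Literature.AlgebraicGeometry.HodgeTheory.bfSingleAdmissible' n X₀ I E))

variable {𝒪 : ObjClass} {C : ChernCharacterBetti}

/-! ## §2 Exact glue: G1♭ ⟺ Off ∧ At; the stub junction -/

/-- **G1♭ ⟹ Off** (drop the presentation hypothesis). [cite: Markman2025SecantWeil, Thm. 1.4.1 (item 4)] -/
theorem offHyperelliptic_of_pinnedLevelTransfer63 (h : SecantQuotientPinnedAnchorLevelTransfer63 𝒪) :
    SecantQuotientPinnedAnchorLevelTransfer63OffHyperelliptic 𝒪 :=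
  fun d _ _ _ _ hX hpin _ hX' hsrc ↦ h d hX hpin hX' hsrc

/-- **G1♭ ⟹ At** (drop the presentation hypothesis). [cite: Markman2025SecantWeil, Thm. 1.4.1 (item 4)] -/
theorem atHyperelliptic_of_pinnedLevelTransfer63 (h : SecantQuotientPinnedAnchorLevelTransfer63 𝒪) :
    SecantQuotientPinnedAnchorLevelTransfer63AtHyperelliptic 𝒪 :=
  fun d _ _ _ _ hX hpin _ hX' hsrc ↦ h d hX hpin hX' hsrc

/-- **Off ∧ At ⟹ G1♭**: a pinned target is presented by the datum of its pinning class (`IsSecantQuotientWeilClassAtPinned.exists_pin`), whose Jacobian is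
hyperelliptic or not (excluded middle). [cite: Markman2025SecantWeil, §1.5 (p. 7) and §9 (p. 57)] [cite: ArbarelloCornalbaGriffithsHarris1985, Ch. I §2 (p. 10)] -/
theorem pinnedLevelTransfer63_of_offHyperelliptic_of_atHyperelliptic (hoff : SecantQuotientPinnedAnchorLevelTransfer63OffHyperelliptic 𝒪)
    (hat : SecantQuotientPinnedAnchorLevelTransfer63AtHyperelliptic 𝒪) : SecantQuotientPinnedAnchorLevelTransfer63 𝒪 := by
  intro d X X' θ θ' hX hpin hX' hsrc
  obtain ⟨γ, hγ⟩ := hpin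
  obtain ⟨D, e, θ₀, hθ₀, hθ⟩ := IsSecantQuotientWeilClassAtPinned.exists_pin hγ
  by_cases hC : D.𝒥.IsHyperelliptic
  · exact hat d hX ⟨γ, hγ⟩ ⟨D, e, θ₀, hC, hθ₀, hθ⟩ hX' hsrc
  · exact hoff d hX ⟨γ, hγ⟩ ⟨D, e, θ₀, hC, hθ₀, hθ⟩ hX' hsrc

/-- **G1♭ ⟺ Off ∧ At — EXACTLY.** [cite: Markman2025SecantWeil, §9 (p. 57) and Thm. 1.4.1 (item 4)] [cite: ArbarelloCornalbaGriffithsHarris1985, Ch. I §2 (p. 10)] -/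
theorem pinnedLevelTransfer63_iff_offHyperelliptic_and_atHyperelliptic :
    SecantQuotientPinnedAnchorLevelTransfer63 𝒪 ↔
      SecantQuotientPinnedAnchorLevelTransfer63OffHyperelliptic 𝒪 ∧ SecantQuotientPinnedAnchorLevelTransfer63AtHyperelliptic 𝒪 :=
  ⟨fun h ↦ ⟨offHyperelliptic_of_pinnedLevelTransfer63 h, atHyperelliptic_of_pinnedLevelTransfer63 h⟩,
    fun h ↦ pinnedLevelTransfer63_of_offHyperelliptic_of_atHyperelliptic h.1 h.2⟩

/-- The primed instance: `G1♭′(C) ⟺ Off′(C) ∧ At′(C)`. [cite: Markman2025SecantWeil, §9 (p. 57)] -/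
theorem pinnedLevelTransfer63PinnedPrime_iff_offHyperelliptic_and_atHyperelliptic :
    SecantQuotientPinnedAnchorLevelTransfer63PinnedPrime C ↔
      SecantQuotientPinnedAnchorLevelTransfer63OffHyperellipticPinnedPrime C ∧
        SecantQuotientPinnedAnchorLevelTransfer63AtHyperellipticPinnedPrime C :=
  pinnedLevelTransfer63_iff_offHyperelliptic_and_atHyperelliptic

/-- **node ⟺ Off ∧ At ∧ G3** (with p566937's `weilDirectionTransfer63_iff_pinnedLevelTransfer_and_sameAnchor`): ring2-b03x's node is print's territory, the
hyperelliptic closedness, and the same-anchor transfer — three named pieces, nothing else. [cite: Markman2025SecantWeil, Thm. 1.4.1 (item 4) and §9 (p. 57)] -/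
theorem weilDirectionTransfer63_iff_off_and_at_and_sameAnchor :
    SecantQuotientWeilDirectionTransfer63 𝒪 ↔
      SecantQuotientPinnedAnchorLevelTransfer63OffHyperelliptic 𝒪 ∧ SecantQuotientPinnedAnchorLevelTransfer63AtHyperelliptic 𝒪 ∧
      ∀ (d : ℕ) ⦃X : SchemeOver ℂ⦄ ⦃θ : complexBetti X 2⦄ ⦃w w' : complexBetti X (2 * 3)⦄,
        IsSecantQuotientAnchorWith d X θ → w ∈ secantQuotientServedClassesPinned X θ → IsRationalClass w →
        w' ∈ secantQuotientServedClassesPinned X θ → IsRationalClass w' → w' ∈ carriedClasses 𝒪 6 3 X θ →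
        w ∈ carriedClasses 𝒪 6 3 X θ := by
  rw [weilDirectionTransfer63_iff_pinnedLevelTransfer_and_sameAnchor, pinnedLevelTransfer63_iff_offHyperelliptic_and_atHyperelliptic, and_assoc]

/-- **STUB 2a‴ FROM PRINT, Off, At AND G3: `L1″(C, AdmTw′) ∧ Off′ ∧ At′ ∧ G3′ ⟹ SecantQuotientAnchorCarrier63PinnedPrime C`.** Nothing here says any input
holds. [cite: Markman2025SecantWeil, Thm. 1.4.1 (item 4), §1.5, §9 (p. 57) and Lemma 9.3.11] [cite: Bloch1972Semiregularity, Remark (7.5)] [cite: BuchweitzFlenner2003, §5 Thm. 5.1] -/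
theorem secantQuotientAnchorCarrier63PinnedPrime_of_pinned_of_off_of_at_of_sameAnchor
    (hM : Markman2025_secantQuotient_twistedCarrier_onJacobian_pinned C
      (fun n X₀ I E => Summit.Ventures.HSemireg.gluableSigmaAdmissible n X₀ I E ∨
        Literature.AlgebraicGeometry.HodgeTheory.bfSingleAdmissible' n X₀ I E))
    (hoff : SecantQuotientPinnedAnchorLevelTransfer63OffHyperellipticPinnedPrime C)
    (hat : SecantQuotientPinnedAnchorLevelTransfer63AtHyperellipticPinnedPrime C)
    (hG3 : ∀ (d : ℕ) ⦃X : SchemeOver ℂ⦄ ⦃θ : complexBetti X 2⦄ ⦃w w' : complexBetti X (2 * 3)⦄,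
      IsSecantQuotientAnchorWith d X θ → w ∈ secantQuotientServedClassesPinned X θ → IsRationalClass w →
      w' ∈ secantQuotientServedClassesPinned X θ → IsRationalClass w' →
      w' ∈ carriedClasses (Literature.AlgebraicGeometry.HodgeTheory.twistedReflexiveClass C
        (fun n X₀ I E => Summit.Ventures.HSemireg.gluableSigmaAdmissible n X₀ I E ∨
          Literature.AlgebraicGeometry.HodgeTheory.bfSingleAdmissible' n X₀ I E)) 6 3 X θ →
      w ∈ carriedClasses (Literature.AlgebraicGeometry.HodgeTheory.twistedReflexiveClass C
        (fun n X₀ I E => Summit.Ventures.HSemireg.gluableSigmaAdmissible n X₀ I E ∨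
          Literature.AlgebraicGeometry.HodgeTheory.bfSingleAdmissible' n X₀ I E)) 6 3 X θ) :
    SecantQuotientAnchorCarrier63PinnedPrime C :=
  secantQuotientAnchorCarrier63PinnedPrime_of_pinned_of_pinnedLevelTransfer_of_sameAnchor hM
    (pinnedLevelTransfer63_of_offHyperelliptic_of_atHyperelliptic hoff hat) hG3

end Summit.HodgeConjecture.HodgeConjecture.Ring2.SemiregularRepresentatives

end
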